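import Summits.CriticalPhenomena.PercolationContinuityZ3.Theses.PercNearOneGluing
import Literature.Probability.Percolation.PercolationEvents
import HarnessLib.Audit
import Literature.Probability.LatticeModels.ProdBernoulliIndependence
import Summits.CriticalPhenomena.PercolationContinuityZ3.Theorems.PercNearOneGluingAdditiveGluingOneBond
import Summits.CriticalPhenomena.PercolationContinuityZ3.Theorems.PercNearOneGluingAdditiveGluingKnLemma3Mixed
import Summits.CriticalPhenomena.PercolationContinuityZ3.Theorems.PercNearOneGluingNearOneGluingPivotalityDomination

/-! TTRL-lite variant V2459 of stmt-CriticalPhenomena-4574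

(`stub_shorteningStep` of line `kn_shortening_induction`, move `small_case+small_case`:
`A.card = 3` and `n ≤ 5`).  Kozma–Nitzan's SHORTENING STEP (arXiv:2401.12397, Conjecture 6, p. 34)
against the OLD minimiser `a₀`, for three relays on at most five vertices — proved outright (the
displayed induction hypothesis is not used).

Write `μ = prodBernoulli w`, `μ₁ = prodBernoulli (w[s(v,x) ↦ 1])`, `V = {v, x}`.
* COVER LEMMA (`stub_shorteningStep_var2459_cover`, the `|A| ≤ 2` argument of the sibling variant
  V2415 run with a general "second relay" `c`): if `μ(a₀ ↔ b) ≤ μ(c ↔ b)` and every relay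
  `a ∈ A` is one of `a₀, b, c` (or `c = x`, in which case `{V ↔ c}` is sure), then
  `μ₁(v ↔ A) μ₁(a₀ ↔ b) ≤ μ₁(v ↔ b)`.  Proof: transport to `μ` along `ω ↦ insert s(v,x) ω`, Harris,
  and Kozma–Nitzan Lemma 3 for the mixed-monotone set-observer event `{V ↔ c} ∩ {V ↮ a₀}`
  (`knLemma3Mixed_setObserver_star`); the relay `b` itself never contributes off `{a₀ ↔ V}`.
* CASES.  `x ∈ A`: cover lemma with `c = x`.  `x ∉ A`: then `A ∪ {v, x}` has five elements, so it
  is all of `Fin n` and `b ∈ A ∪ {v, x}`; `b = v` and `b = x` are trivial (`μ₁(v ↔ b) = 1`),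
  `b ∈ A ∖ {a₀}` is the cover lemma with `c` the third relay, and `b = a₀` forces
  `μ(a ↔ a₀) = 1` for every relay (minimiser hypothesis), whence `μ₁(v ↔ A) ≤ μ₁(v ↔ a₀)`.
No new definitions, no named facts. -/

namespace Summit.CriticalPhenomena.PercolationContinuityZ3.Theorems

open MeasureTheory Set Literature.Probability.LatticeModels Literature.Probability.Percolation
open scoped Classical BigOperators

/-- Transport inequality: gluing the pair `{v, x}` (weight of `s(v,x)` raised to `1`) can only
increase a connection probability, `μ_w(y ↔ z) ≤ μ_{w[s(v,x)↦1]}(y ↔ z)`. -/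
theorem stub_shorteningStep_var2459_mono (n : ℕ) (w : Sym2 (Fin n) → unitInterval)
    (v x y z : Fin n) :
    (prodBernoulli w).real (openConn y z) ≤
      (prodBernoulli (Function.update w s(v, x) 1)).real (openConn y z) := by
  have hmi : Measurable fun ω : BondConfig (Fin n) => insert s(v, x) ω := by
    refine measurable_set_iff.2 fun i => ?_
    simp only [Set.mem_insert_iff]
    exact measurable_const.or (measurable_set_mem i)
  rw [← goodStepEI_prodBernoulli_map_insert w s(v, x),
    map_measureReal_apply hmi MeasurableSet.of_discrete]
  exact measureReal_mono fun ω hω =>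
    (hω : (openGraph ω).Reachable y z).mono (openGraph_mono (Set.subset_insert _ _))

/-- Under the glued measure `μ_{w[s(v,x)↦1]}` the pair `v ≠ x` is almost surely connected:
`μ_{w[s(v,x)↦1]}(v ↔ x) = 1`. -/
theorem stub_shorteningStep_var2459_glued (n : ℕ) (w : Sym2 (Fin n) → unitInterval)
    (v x : Fin n) (hvx : v ≠ x) :
    (prodBernoulli (Function.update w s(v, x) 1)).real (openConn v x) = 1 := by
  have hmi : Measurable fun ω : BondConfig (Fin n) => insert s(v, x) ω := by
    refine measurable_set_iff.2 fun i => ?_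
    simp only [Set.mem_insert_iff]
    exact measurable_const.or (measurable_set_mem i)
  refine le_antisymm measureReal_le_one ?_
  rw [← goodStepEI_prodBernoulli_map_insert w s(v, x),
    map_measureReal_apply hmi MeasurableSet.of_discrete]
  have huniv : (fun ω : BondConfig (Fin n) => insert s(v, x) ω) ⁻¹' (openConn v x) = Set.univ := by
    refine Set.eq_univ_of_forall fun ω => ?_
    exact pivDom_reachable_insert_of ω hvx (SimpleGraph.Reachable.refl x)
  rw [huniv, probReal_univ]

/-- COVER LEMMA (the heart of the sibling variant V2415, with a general second relay `c`):
if `μ_w(a₀ ↔ b) ≤ μ_w(c ↔ b)` and every relay of `A` is `a₀`, `b` or `c` (or `c = x`), then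
`μ₁(v ↔ A) · μ₁(a₀ ↔ b) ≤ μ₁(v ↔ b)` for the glued measure `μ₁ = prodBernoulli (w[s(v,x) ↦ 1])`.
Transport along `ω ↦ insert s(v,x) ω`, Harris, and Kozma–Nitzan Lemma 3 (mixed, set observer
`{v, x}`, `knLemma3Mixed_setObserver_star`). -/
theorem stub_shorteningStep_var2459_cover (n : ℕ) (w : Sym2 (Fin n) → unitInterval)
    (A : Finset (Fin n)) (b v x a₀ c : Fin n) (hvx : v ≠ x)
    (hmin : (prodBernoulli w).real (openConn a₀ b) ≤ (prodBernoulli w).real (openConn c b))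
    (hcov : ∀ a ∈ A, a = a₀ ∨ a = b ∨ a = c ∨ c = x) :
    (prodBernoulli (Function.update w s(v, x) 1)).real (⋃ a ∈ A, openConn v a) *
        (prodBernoulli (Function.update w s(v, x) 1)).real (openConn a₀ b) ≤
      (prodBernoulli (Function.update w s(v, x) 1)).real (openConn v b) := by
  -- every event is measurable on the finite configuration space
  have hmeas : ∀ S : Set (BondConfig (Fin n)), MeasurableSet S := fun S =>
    MeasurableSet.of_discrete
  -- transport along `ω ↦ insert s(v,x) ω`, whose image measure is the glued measure
  have hmi : Measurable fun ω : BondConfig (Fin n) => insert s(v, x) ω := by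
    refine measurable_set_iff.2 fun i => ?_
    simp only [Set.mem_insert_iff]
    exact measurable_const.or (measurable_set_mem i)
  have htrans : ∀ F : Set (BondConfig (Fin n)),
      (prodBernoulli (Function.update w s(v, x) 1)).real F =
        (prodBernoulli w).real ((fun ω : BondConfig (Fin n) => insert s(v, x) ω) ⁻¹' F) := by
    intro F
    rw [← goodStepEI_prodBernoulli_map_insert w s(v, x), map_measureReal_apply hmi (hmeas F)]
  -- the events of the uncontracted graph (`V = {v, x}`)
  set Fb : Set (BondConfig (Fin n)) := openConn v b ∪ openConn x b with hFb
  set E : Set (BondConfig (Fin n)) :=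
    (openConn v a₀ ∪ openConn x a₀) ∪ ((openConn v c ∪ openConn x c) ∪ (openConn v b ∪ openConn x b))
    with hE
  set K : Set (BondConfig (Fin n)) :=
    openConn a₀ b ∪ ((openConn a₀ v ∩ openConn x b) ∪ (openConn a₀ x ∩ openConn v b)) with hK
  set T : Set (BondConfig (Fin n)) := openConn a₀ v ∪ openConn a₀ x with hT
  set Q : Set (BondConfig (Fin n)) :=
    {ω | (∃ y ∈ ({v, x} : Finset (Fin n)), (openGraph ω).Reachable c y) ∧
      ∀ y ∈ ({v, x} : Finset (Fin n)), ¬ (openGraph ω).Reachable a₀ y} with hQ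
  set Sb : Set (BondConfig (Fin n)) :=
    {ω | ∃ y ∈ ({v, x} : Finset (Fin n)), (openGraph ω).Reachable y b} with hSb
  -- (1) the three transports
  have hX : (prodBernoulli w).real Fb ≤
      (prodBernoulli (Function.update w s(v, x) 1)).real (openConn v b) := by
    rw [htrans]
    refine measureReal_mono (fun ω hω => ?_)
    rcases hω with h | h
    · exact (h : (openGraph ω).Reachable v b).mono (openGraph_mono (Set.subset_insert _ _))
    · exact pivDom_reachable_insert_of ω hvx h
  have hY : (prodBernoulli (Function.update w s(v, x) 1)).real (⋃ a ∈ A, openConn v a) ≤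
      (prodBernoulli w).real E := by
    rw [htrans]
    refine measureReal_mono (fun ω hω => ?_)
    simp only [Set.mem_preimage, Set.mem_iUnion, exists_prop] at hω
    obtain ⟨a, ha, h⟩ := hω
    have h' : (openGraph ω).Reachable v a ∨ (openGraph ω).Reachable x a := by
      rcases pivDom_reachable_insert ω v x v a h with h1 | ⟨-, h1⟩ | ⟨-, h1⟩
      exacts [Or.inl h1, Or.inr h1, Or.inl h1]
    rcases hcov a ha with h0 | h0 | h0 | h0
    · rw [h0] at h'
      exact Or.inl h'
    · rw [h0] at h'
      exact Or.inr (Or.inr h')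
    · rw [h0] at h'
      exact Or.inr (Or.inl h')
    · have hxc : (openGraph ω).Reachable x c := by subst h0; exact SimpleGraph.Reachable.refl _
      exact Or.inr (Or.inl (Or.inr hxc))
  have hZ : (prodBernoulli (Function.update w s(v, x) 1)).real (openConn a₀ b) ≤
      (prodBernoulli w).real K := by
    rw [htrans]
    refine measureReal_mono (fun ω hω => ?_)
    rcases pivDom_reachable_insert ω v x a₀ b hω with h1 | ⟨h1, h2⟩ | ⟨h1, h2⟩
    exacts [Or.inl h1, Or.inr (Or.inl ⟨h1, h2⟩), Or.inr (Or.inr ⟨h1, h2⟩)]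
  -- (2) Harris for the increasing events `E`, `K`
  have hEup : IsUpperSet E :=
    ((isUpperSet_openConn v a₀).union (isUpperSet_openConn x a₀)).union
      (((isUpperSet_openConn v c).union (isUpperSet_openConn x c)).union
        ((isUpperSet_openConn v b).union (isUpperSet_openConn x b)))
  have hKup : IsUpperSet K :=
    (isUpperSet_openConn a₀ b).union
      (((isUpperSet_openConn a₀ v).inter (isUpperSet_openConn x b)).union
        ((isUpperSet_openConn a₀ x).inter (isUpperSet_openConn v b)))
  have hHarris : (prodBernoulli w).real E * (prodBernoulli w).real K ≤
      (prodBernoulli w).real (E ∩ K) :=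
    prodBernoulli_harris w hEup hKup (hmeas _) (hmeas _)
  -- (3) event algebra
  have hsplit : E ∩ K ⊆ (Fb ∩ T) ∪ (openConn a₀ b ∩ Q) := by
    rintro ω ⟨hωE, hωK⟩
    by_cases hT' : ω ∈ T
    · left
      refine ⟨?_, hT'⟩
      rcases hωK with hab | ⟨_, hxb⟩ | ⟨_, hvb⟩
      · rcases hT' with hav | hax
        · exact Or.inl ((SimpleGraph.Reachable.symm hav).trans hab)
        · exact Or.inr ((SimpleGraph.Reachable.symm hax).trans hab)
      · exact Or.inr hxb
      · exact Or.inl hvb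
    · right
      have hav : ¬ (openGraph ω).Reachable a₀ v := fun h => hT' (Or.inl h)
      have hax : ¬ (openGraph ω).Reachable a₀ x := fun h => hT' (Or.inr h)
      have hab : (openGraph ω).Reachable a₀ b := by
        rcases hωK with hab | ⟨h, _⟩ | ⟨h, _⟩
        exacts [hab, absurd h hav, absurd h hax]
      refine ⟨hab, ?_, ?_⟩
      · rcases hωE with (h | h) | ((h | h) | (h | h))
        · exact absurd (SimpleGraph.Reachable.symm h) hav
        · exact absurd (SimpleGraph.Reachable.symm h) hax
        · exact ⟨v, by simp, SimpleGraph.Reachable.symm h⟩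
        · exact ⟨x, by simp, SimpleGraph.Reachable.symm h⟩
        · exact absurd (hab.trans (SimpleGraph.Reachable.symm h)) hav
        · exact absurd (hab.trans (SimpleGraph.Reachable.symm h)) hax
      · intro y hy
        simp only [Finset.mem_insert, Finset.mem_singleton] at hy
        rcases hy with hy | hy
        · rw [hy]; exact hav
        · rw [hy]; exact hax
  have hSbQ : Sb ∩ Q ⊆ Fb \ T := by
    rintro ω ⟨⟨y, hy, hyb⟩, -, hno⟩
    refine ⟨?_, ?_⟩
    · simp only [Finset.mem_insert, Finset.mem_singleton] at hy
      rcases hy with hy | hy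
      · rw [hy] at hyb; exact Or.inl hyb
      · rw [hy] at hyb; exact Or.inr hyb
    · rintro (h | h)
      · exact hno v (by simp) h
      · exact hno x (by simp) h
  -- (4) Kozma–Nitzan Lemma 3 (mixed, set observer `{v, x}`), fed by the minimiser hypothesis
  have hL3 : (prodBernoulli w).real (openConn a₀ b ∩ Q) ≤ (prodBernoulli w).real (Sb ∩ Q) + 0 :=
    knLemma3Mixed_setObserver_star n w a₀ c b ({v, x} : Finset (Fin n)) 0 le_rfl
      (by rw [add_zero]; exact hmin)
  -- (5) assemble
  have hFsum : (prodBernoulli w).real (Fb ∩ T) + (prodBernoulli w).real (Fb \ T) =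
      (prodBernoulli w).real Fb :=
    measureReal_inter_add_sdiff (hmeas T)
  have h1 : (prodBernoulli w).real (E ∩ K) ≤
      (prodBernoulli w).real (Fb ∩ T) + (prodBernoulli w).real (openConn a₀ b ∩ Q) :=
    (measureReal_mono hsplit).trans (measureReal_union_le _ _)
  have h2 : (prodBernoulli w).real (Sb ∩ Q) ≤ (prodBernoulli w).real (Fb \ T) :=
    measureReal_mono hSbQ
  calc (prodBernoulli (Function.update w s(v, x) 1)).real (⋃ a ∈ A, openConn v a) *
        (prodBernoulli (Function.update w s(v, x) 1)).real (openConn a₀ b)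
      ≤ (prodBernoulli w).real E * (prodBernoulli w).real K :=
        mul_le_mul hY hZ measureReal_nonneg measureReal_nonneg
    _ ≤ (prodBernoulli w).real (E ∩ K) := hHarris
    _ ≤ (prodBernoulli w).real Fb := by linarith
    _ ≤ (prodBernoulli (Function.update w s(v, x) 1)).real (openConn v b) := hX

/-- DEGENERATE TARGET `b = a₀`: if every relay `a ∈ A` satisfies `μ_w(a₀ ↔ a₀) ≤ μ_w(a ↔ a₀)`
(i.e. is almost surely glued to `a₀`), then `μ₁(v ↔ A) · μ₁(a₀ ↔ a₀) ≤ μ₁(v ↔ a₀)` for the glued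
measure `μ₁ = prodBernoulli (w[s(v,x) ↦ 1])` (union bound over the null events `{a ↮ a₀}`). -/
theorem stub_shorteningStep_var2459_self (n : ℕ) (w : Sym2 (Fin n) → unitInterval)
    (A : Finset (Fin n)) (v x a₀ : Fin n)
    (hmin : ∀ a ∈ A, (prodBernoulli w).real (openConn a₀ a₀) ≤ (prodBernoulli w).real (openConn a a₀)) :
    (prodBernoulli (Function.update w s(v, x) 1)).real (⋃ a ∈ A, openConn v a) *
        (prodBernoulli (Function.update w s(v, x) 1)).real (openConn a₀ a₀) ≤
      (prodBernoulli (Function.update w s(v, x) 1)).real (openConn v a₀) := by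
  set μ₁ := prodBernoulli (Function.update w s(v, x) 1) with hμ₁
  have hself : ∀ (p : Sym2 (Fin n) → unitInterval) (z : Fin n),
      (prodBernoulli p).real (openConn z z) = 1 := by
    intro p z
    have : (openConn z z : Set (BondConfig (Fin n))) = Set.univ :=
      Set.eq_univ_of_forall fun ω => (SimpleGraph.Reachable.refl z : (openGraph ω).Reachable z z)
    rw [this, probReal_univ]
  -- each `{a ↮ a₀}` is `μ₁`-null
  have hnull : ∀ a ∈ A, μ₁.real (openConn a a₀)ᶜ ≤ 0 := by
    intro a ha
    have h1 : (1 : ℝ) ≤ μ₁.real (openConn a a₀) := by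
      calc (1 : ℝ) = (prodBernoulli w).real (openConn a₀ a₀) := (hself w a₀).symm
        _ ≤ (prodBernoulli w).real (openConn a a₀) := hmin a ha
        _ ≤ μ₁.real (openConn a a₀) := stub_shorteningStep_var2459_mono n w v x a a₀
    have h2 : μ₁.real (openConn a a₀) + μ₁.real (openConn a a₀)ᶜ = 1 :=
      probReal_add_probReal_compl MeasurableSet.of_discrete
    linarith
  have hsub : (⋃ a ∈ A, openConn v a : Set (BondConfig (Fin n))) ⊆
      openConn v a₀ ∪ ⋃ a ∈ A, (openConn a a₀)ᶜ := by
    intro ω hω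
    simp only [Set.mem_iUnion, exists_prop] at hω
    obtain ⟨a, ha, hva⟩ := hω
    by_cases haa : ω ∈ openConn a a₀
    · exact Or.inl ((hva : (openGraph ω).Reachable v a).trans haa)
    · exact Or.inr (Set.mem_biUnion (show a ∈ (A : Set (Fin n)) from ha) haa)
  have hsum : ∑ a ∈ A, μ₁.real (openConn a a₀)ᶜ ≤ 0 :=
    Finset.sum_nonpos hnull
  have hle : μ₁.real (⋃ a ∈ A, openConn v a) ≤ μ₁.real (openConn v a₀) :=
    calc μ₁.real (⋃ a ∈ A, openConn v a)
        ≤ μ₁.real (openConn v a₀ ∪ ⋃ a ∈ A, (openConn a a₀)ᶜ) := measureReal_mono hsub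
      _ ≤ μ₁.real (openConn v a₀) + μ₁.real (⋃ a ∈ A, (openConn a a₀)ᶜ) :=
          measureReal_union_le _ _
      _ ≤ μ₁.real (openConn v a₀) + ∑ a ∈ A, μ₁.real (openConn a a₀)ᶜ := by
          gcongr
          exact measureReal_biUnion_finset_le A fun a => (openConn a a₀)ᶜ
      _ ≤ μ₁.real (openConn v a₀) := by linarith
  calc μ₁.real (⋃ a ∈ A, openConn v a) * μ₁.real (openConn a₀ a₀)
      ≤ μ₁.real (⋃ a ∈ A, openConn v a) * 1 :=
        mul_le_mul_of_nonneg_left measureReal_le_one measureReal_nonneg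
    _ ≤ μ₁.real (openConn v a₀) := by rw [mul_one]; exact hle

/-- TTRL-lite variant V2459 of `stub_shorteningStep` (stmt-CriticalPhenomena-4574): Kozma–Nitzan's
shortening step (Conjecture 6 of arXiv:2401.12397, measured against the minimiser `a₀` of the
uncontracted graph) for `A.card = 3` relays on `n ≤ 5` vertices.  Proof by cases: `x ∈ A` is the
cover lemma with second relay `c = x`; otherwise `A ∪ {v, x} = Fin n`, so `b` is `v` or `x`
(trivial, `μ₁(v ↔ b) = 1`), the minimiser `a₀` (all relays a.s. glued to `a₀`), or a relay
`b ≠ a₀` (cover lemma with `c` the third relay).  The induction hypothesis is not used. -/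
theorem stub_shorteningStep_var2459 : ∀ (n : ℕ) (w : Sym2 (Fin n) → unitInterval) (A : Finset (Fin n)) (b v x a₀ : Fin n), A.card = 3 → n ≤ 5 → v ∉ A → v ≠ x → w s(v, x) = 0 → a₀ ∈ A → (∀ a ∈ A, (prodBernoulli w).real (openConn a₀ b) ≤ (prodBernoulli w).real (openConn a b)) → (∀ w' : Sym2 (Fin n) → unitInterval, (∀ e, w e = 0 → w' e = 0) → ∀ (A' : Finset (Fin n)) (o' b' : Fin n) (t : ℝ), (∀ a ∈ A', t ≤ (prodBernoulli w').real (openConn a b')) → (prodBernoulli w').real (⋃ a ∈ A', openConn o' a) * t ≤ (prodBernoulli w').real (openConn o' b')) → (prodBernoulli (Function.update w s(v, x) 1)).real (⋃ a ∈ A, openConn v a) * (prodBernoulli (Function.update w s(v, x) 1)).real (openConn a₀ b) ≤ (prodBernoulli (Function.update w s(v, x) 1)).real (openConn v b) := by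
  intro n w A b v x a₀ hcard hn hvA hvx _hw0 ha₀ hmin _hIH
  by_cases hxA : x ∈ A
  · -- second relay `c = x`: `{V ↔ x}` is sure, the cover condition is automatic
    exact stub_shorteningStep_var2459_cover n w A b v x a₀ x hvx (hmin x hxA)
      (fun a _ => Or.inr (Or.inr (Or.inr rfl)))
  · -- `x ∉ A`: `A ∪ {v, x}` has `5 ≥ n` elements, hence is everything
    have hxA' : x ∉ A := hxA
    have hcard5 : (insert v (insert x A)).card = 5 := by
      rw [Finset.card_insert_of_notMem, Finset.card_insert_of_notMem hxA', hcard]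
      simp only [Finset.mem_insert, not_or]
      exact ⟨hvx, hvA⟩
    have hle : (insert v (insert x A)).card ≤ Fintype.card (Fin n) := Finset.card_le_univ _
    rw [Fintype.card_fin] at hle
    have huniv : insert v (insert x A) = Finset.univ :=
      Finset.eq_univ_of_card _ (by rw [Fintype.card_fin]; omega)
    have hb : b = v ∨ b = x ∨ b ∈ A := by
      simpa only [Finset.mem_insert] using (huniv ▸ Finset.mem_univ b : b ∈ insert v (insert x A))
    rcases hb with hbv | hbx | hbA
    · -- `b = v`: the right-hand side is `μ₁(v ↔ v) = 1`
      subst hbv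
      have hvv : (prodBernoulli (Function.update w s(b, x) 1)).real (openConn b b) = 1 := by
        have : (openConn b b : Set (BondConfig (Fin n))) = Set.univ :=
          Set.eq_univ_of_forall fun ω =>
            (SimpleGraph.Reachable.refl b : (openGraph ω).Reachable b b)
        rw [this, probReal_univ]
      rw [hvv]
      exact mul_le_one₀ measureReal_le_one measureReal_nonneg measureReal_le_one
    · -- `b = x`: the right-hand side is `μ₁(v ↔ x) = 1`
      subst hbx
      rw [stub_shorteningStep_var2459_glued n w v b hvx]
      exact mul_le_one₀ measureReal_le_one measureReal_nonneg measureReal_le_one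
    · by_cases hba : b = a₀
      · -- `b = a₀`: every relay is a.s. glued to `a₀`
        subst hba
        exact stub_shorteningStep_var2459_self n w A v x b hmin
      · -- `b ∈ A ∖ {a₀}`: the third relay `c` covers `A = {a₀, b, c}`
        have hbe : b ∈ A.erase a₀ := Finset.mem_erase.2 ⟨hba, hbA⟩
        have h1 : ((A.erase a₀).erase b).card = 1 := by
          rw [Finset.card_erase_of_mem hbe, Finset.card_erase_of_mem ha₀, hcard]
        obtain ⟨c, hc⟩ := Finset.card_eq_one.1 h1
        have hcmem : c ∈ (A.erase a₀).erase b := by rw [hc]; exact Finset.mem_singleton_self c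
        have hcA : c ∈ A := Finset.mem_of_mem_erase (Finset.mem_of_mem_erase hcmem)
        refine stub_shorteningStep_var2459_cover n w A b v x a₀ c hvx (hmin c hcA) ?_
        intro a ha
        by_cases h0 : a = a₀
        · exact Or.inl h0
        by_cases h1' : a = b
        · exact Or.inr (Or.inl h1')
        have : a ∈ (A.erase a₀).erase b := Finset.mem_erase.2 ⟨h1', Finset.mem_erase.2 ⟨h0, ha⟩⟩
        rw [hc, Finset.mem_singleton] at this
        exact Or.inr (Or.inr (Or.inl this))

end Summit.CriticalPhenomena.PercolationContinuityZ3.Theorems
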